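import Literature.Combinatorics.SimpleGraph.HamiltonianIteratedSubstitution
import HarnessLib

/-!
# Gadget substitution for Hamiltonian-path counts: families of gadgets with 0/1 table censuses

A corollary of the iterated substitution theorem `GadgetFamily.Valid.hamCountRF_graphUpTo`
(`HamiltonianIteratedSubstitution.lean`; Garey–Johnson 1979, §3.2.2, as used by
Liśkiewicz–Ogihara–Toda 2003, §3) for the gadgets actually used in the grid construction of
`#3SAT ≤ #HamPath` (rail gadgets, `HamiltonianRailGadgets.lean`, whose census on a set `U` of
their slots is `1` if `U` belongs to a TABLE `T` of subsets and `0` otherwise): **the number of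
Hamiltonian `s`–`t` paths of the substituted graph is the number of Hamiltonian `s`–`t` paths of the
base graph whose set of used slots of every gadget lies in that gadget's table**
(`GadgetFamily.Valid.hamCount_graphUpTo_eq_ncard`). The base graph is arbitrary; for the chains of
cells of `CellChain.lean` the right-hand side is a number of index vectors.

## References

* M. R. Garey, D. S. Johnson, *Computers and Intractability*, Freeman 1979, §3.2.2.
* M. Liśkiewicz, M. Ogihara, S. Toda, TCS 304 (2003) 129–156, §3 (proof of Lemma 4).
-/

namespace Literature.Combinatorics.SimpleGraph

open Finset

variable {α : Type*} [DecidableEq α]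

/-- **Counting by fibres of the used-slot map**: for a finite set `H` of lists and a finite set of
"slots" `S`, summing over the subsets `U ⊆ S` the indicator of a property `P U` times the number of
members of `H` using exactly the slots `U` counts the members whose set of used slots has `P`.
[folklore] -/
theorem sum_powerset_ite_card_filter_eq (H : Finset (List α)) (S : Finset (α × α)) (P : Finset (α × α) → Prop)
    [DecidablePred P] :
    ∑ U ∈ S.powerset, (if P U then 1 else 0) * (H.filter fun l => S.filter (fun e => Uses l e) = U).card =
      (H.filter fun l => P (S.filter fun e => Uses l e)).card := by
  rw [card_eq_sum_card_fiberwise (f := fun l => S.filter fun e => Uses l e) (t := S.powerset)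
    (fun l _ => mem_powerset.2 (filter_subset _ _))]
  refine sum_congr rfl fun U _ => ?_
  by_cases hP : P U
  · rw [if_pos hP, one_mul]
    congr 1
    ext l
    rw [mem_filter, mem_filter, mem_filter]
    constructor
    · rintro ⟨hl, hU⟩; exact ⟨⟨hl, hU ▸ hP⟩, hU⟩
    · rintro ⟨⟨hl, -⟩, hU⟩; exact ⟨hl, hU⟩
  · rw [if_neg hP, zero_mul, eq_comm, card_eq_zero, filter_eq_empty_iff]
    intro l hl hU
    rw [mem_filter] at hl
    exact hP (hU ▸ hl.2)

/-- Using every slot of `U ⊆ S` and no slot of `S \\ U` means using exactly the slots `U` of `S`.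
[folklore] -/
theorem usesAll_usesNone_iff_filter_eq {l : List α} {S U : Finset (α × α)} (hU : U ⊆ S) :
    ((∀ e ∈ U, Uses l e) ∧ ∀ e ∈ S \ U, ¬ Uses l e) ↔ S.filter (fun e => Uses l e) = U := by
  constructor
  · rintro ⟨hR, hF⟩
    ext e
    simp only [mem_filter]
    constructor
    · rintro ⟨heS, he⟩
      by_contra heU
      exact hF e (mem_sdiff.2 ⟨heS, heU⟩) he
    · intro he; exact ⟨hU he, hR e he⟩
  · rintro rfl
    exact ⟨fun e he => (mem_filter.1 he).2, fun e he hle => (mem_sdiff.1 he).2 (mem_filter.2 ⟨(mem_sdiff.1 he).1, hle⟩)⟩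

namespace GadgetFamily

variable {M : _root_.SimpleGraph α} {V : Finset α} {𝒢 : GadgetFamily α}

/-- The product of table indicators over the gadgets is the indicator of "every gadget's used set is
in its table". [folklore] -/
theorem prod_ite_mem_eq (T : ℕ → Finset (Finset (α × α))) (U : Finset (α × α)) (k : ℕ) :
    ∏ i ∈ range k, (if U ∩ 𝒢.S i ∈ T i then 1 else 0) = if ∀ i < k, U ∩ 𝒢.S i ∈ T i then 1 else 0 := by
  induction k with
  | zero => simp
  | succ k ih =>
    rw [prod_range_succ, ih]
    by_cases h : ∀ i < k, U ∩ 𝒢.S i ∈ T i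
    · by_cases hk : U ∩ 𝒢.S k ∈ T k
      · have hall : ∀ i < k + 1, U ∩ 𝒢.S i ∈ T i := fun i hi => by
          rcases Nat.lt_succ_iff_lt_or_eq.1 hi with hi | rfl
          exacts [h i hi, hk]
        rw [if_pos h, if_pos hk, if_pos hall, mul_one]
      · rw [if_neg hk, mul_zero, if_neg fun h' => hk (h' k (Nat.lt_succ_self k))]
    · rw [if_neg h, zero_mul, if_neg fun h' => h fun i hi => h' i (Nat.lt_succ_of_lt hi)]

/-- **Hamiltonian paths of a graph with substituted table gadgets are the Hamiltonian paths of the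
base graph whose used slots match the tables.** For a valid family of `n` gadgets whose census on
every set `U` of its slots is `1` if `U ∈ T i` and `0` otherwise, and end points `s, t` of the base:
`#Ham(graphUpTo n) = #{l Hamiltonian s–t path of M through V | ∀ i < n, (S i ∩ used slots of l) ∈ T i}`.
[cite: GareyJohnson1979, §3.2.2 (local replacement)] -/
theorem Valid.hamCount_graphUpTo_eq_ncard {n : ℕ} (hv : Valid M V 𝒢 n) {s t : α} (hs : s ∈ V) (ht : t ∈ V)
    (T : ℕ → Finset (Finset (α × α)))
    (hT : ∀ i < n, ∀ U ⊆ 𝒢.S i, coverCount (𝒢.GX i) (𝒢.VX i) U = if U ∈ T i then 1 else 0) :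
    hamCount (graphUpTo M V 𝒢 n) (vertsUpTo V 𝒢 n) s t =
      {l | IsHamPathOn M V s t l ∧ ∀ i < n, (𝒢.S i).filter (fun e => Uses l e) ∈ T i}.ncard := by
  classical
  -- the substitution theorem with no constraints
  have hmain := hv.hamCountRF_graphUpTo hs ht n le_rfl ∅ ∅ (by simp) (by simp)
  rw [hamCount_eq, hmain]
  simp only [empty_union]
  -- the finite set of Hamiltonian paths of the base
  set H : Finset (List α) := (hamSetRF_finite M V s t ∅ ∅).toFinset with hH
  have hmemH : ∀ l, l ∈ H ↔ IsHamPathOn M V s t l := fun l => by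
    rw [hH, Set.Finite.mem_toFinset, mem_hamSetRF_empty]
  set S := slotsBelow 𝒢 n with hSdef
  -- each constrained count is a fibre of the used-slot map
  have hfib : ∀ U ∈ S.powerset, hamCountRF M V s t U (S \ U) = (H.filter fun l => S.filter (fun e => Uses l e) = U).card := by
    intro U hU
    rw [hamCountRF, ← Set.ncard_coe_finset]
    congr 1
    ext l
    simp only [hamSetRF, Set.mem_setOf_eq, coe_filter, hmemH, usesAll_usesNone_iff_filter_eq (mem_powerset.1 hU)]
  -- each product of censuses is a table indicator
  have hprod : ∀ U ∈ S.powerset, ∏ i ∈ range n, coverCount (𝒢.GX i) (𝒢.VX i) (U ∩ 𝒢.S i) =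
      if ∀ i < n, U ∩ 𝒢.S i ∈ T i then 1 else 0 := by
    intro U _
    rw [← prod_ite_mem_eq T U n]
    exact prod_congr rfl fun i hi => hT i (mem_range.1 hi) _ inter_subset_right
  rw [sum_congr rfl fun U hU => by rw [hprod U hU, hfib U hU],
    sum_powerset_ite_card_filter_eq H S fun U => ∀ i < n, U ∩ 𝒢.S i ∈ T i, ← Set.ncard_coe_finset]
  congr 1
  ext l
  simp only [coe_filter, Set.mem_setOf_eq, hmemH]
  refine and_congr_right fun _ => forall₂_congr fun i hi => ?_
  -- `(S.filter (Uses l)) ∩ S i = (S i).filter (Uses l)` since `S i ⊆ S`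
  have hsub : 𝒢.S i ⊆ S := fun e he => mem_slotsBelow_iff.2 ⟨i, hi, he⟩
  have : S.filter (fun e => Uses l e) ∩ 𝒢.S i = (𝒢.S i).filter fun e => Uses l e := by
    ext e
    simp only [mem_inter, mem_filter]
    constructor
    · rintro ⟨⟨-, h⟩, he⟩; exact ⟨he, h⟩
    · rintro ⟨he, h⟩; exact ⟨⟨hsub he, h⟩, he⟩
  rw [this]

end GadgetFamily

end Literature.Combinatorics.SimpleGraph
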